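import Literature.MathematicalPhysics.QuantumFieldTheory.Balaban1983to89.B8Eq191FlatDirichletConjugation
import Literature.MathematicalPhysics.QuantumLattice.TorusTestPotential

/-!
# `Balaban1983to89.B8Eq191FlatDirichletLipschitzExponent` — [Balaban1985RegularSpaces] (1.101) p. 93 AT `U₀ = 1` WITH DIRICHLET CONDITIONS: THE ADMISSIBLE EXPONENTS
# of the exponential conjugation are the BOND-LIPSCHITZ ones — `|ρ(x) − ρ(x ± e_μ)| ≤ δ′L⁻ʲ` at level-`j` tower sites ([B6] (2.46): the block distance costs `L⁻ʲ` per
# fine bond inside `Bʲ(Λ_j)`) — and for them the weighted-`ℓ²` decay estimate of `B8Eq191FlatDirichletConjugation` holds with explicit smallness «for q sufficiently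
# small» ([B5] p. 36): `δ′ ≤ 1`, `dδ′ ≤ 1`, `4dδ′² ≤ θa₀`, `2d²δ′² ≤ θ`; instance at the concrete cube member `{□_j}`

statement-level skeleton of published theorems with citation tags; proofs where landed; nothing here is a claim about the
Yang–Mills mass gap

T. Bałaban, *Spaces of regular gauge field configurations on a lattice and gauge fixing conditions*, Commun. Math. Phys. **99** (1985) 75–102
`[Balaban1985RegularSpaces]` ("B8"): (1.101) p. 93, (1.131) p. 99, p. 79 (the blocks `Bʲ(y)`); [4] = `[Balaban1985BackgroundPropagators]` Thm 3.1 (3.47) p. 398; [B5] =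
`[Balaban1984PropagatorsI]` p. 36 («e^{−⟨q,x⟩}Δ_a e^{⟨q,x⟩} − Δ_a is a small perturbation of Δ_a for vectors q ∈ R^d sufficiently small»), (1.114) p. 36; [B6] =
`[Balaban1984PropagatorsII]` p. 228 («G(Ω) = (ΩΔ_aΩ)⁻¹»), (2.46) p. 231 («d(y, y′) = inf_Γ |Γ| … A part of Γ contained in Bʲ(Λ_j) consists of bonds of the lattice Λ_j …
d(x, x′) = d(y, y′) if x ∈ Bʲ(y), x′ ∈ Bʲ′(y′)»).

CITATION HEADER (lean-in-tree rule).  Cell `pub-ymgap` (YM Track A, HUMAN RULING D-0062), DAG node N05 = [B8], seat `pub-ymgap-dag-n05-c` (g8), programme (R1′) = [4] Thms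
3.1∕3.2 at `U₀ = 1` with Dirichlet conditions for the consumer `B8Prop6CubeMemberFlatScalar.prop6_cubeMember_flat_of_real` (memo `R1PRIME-PROGRAMME.md` in the seat's HOME).
Brick 1 `B8Eq191FlatDirichletCoercive` (weighted lower bound), brick 2 `B8Eq191FlatDirichletConjugation` (conjugation, weighted Schur test, Agmon solve under the row
hypotheses `hρ1`∕`hρ2`).  THIS FILE is brick 3: it replaces `hρ1`∕`hρ2` by the ONE natural hypothesis on the exponent — bond-Lipschitz at the tower scale — which is
the property of `δ′ ×` any distance whose fine bonds inside `Bʲ(Λ_j)` cost `L⁻ʲ` (the site version of [B6] (2.46)); the distance itself and the counting lemma (2.61)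
are the next bricks.

WHAT THIS FILE PROVES (theorems only; 0 `def`).
* §1 `cosh_sub_one_le_of_abs_le` (from the tree's `QuantumLattice.cosh_sub_one_le_sq_of_abs_le_one`: `cosh t − 1 ≤ t²` on `|t| ≤ 1`, BY NAME).
* §2 `blockMap_add_e_of_lt` (a coordinate step towards a site of the same block stays in the block — blocks are boxes), ★ `abs_sub_le_of_blockLipschitz`
  (in-block bond-Lipschitz ⇒ `|ρ(x) − ρ(z)| ≤ c·Σ_i|x_i − z_i|`, induction on the ℓ¹ distance), `sum_abs_sub_le_of_block` (`Σ_i|x_i − z_i| ≤ d·n` on a block of side `n + 1`,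
  via brick 1's chart).
* §3 ★ `blockOsc_of_lipschitz` (bond-Lipschitz `δ′L⁻ʲ` at level-`j` tower sites + «tower blocks lie in S» ⇒ oscillation `≤ dδ′` on each level-`j` tower block), ★★
  `rowHyps_of_lipschitz` (⇒ `hρ1` ∧ `hρ2` of brick 2 for level weights `a′_j ∈ [a₀, 8]` under `δ′ ≤ 1`, `dδ′ ≤ 1`, `4dδ′² ≤ θa₀`, `2d²δ′² ≤ θ`).
* §4 ★★★ **`agmon_solve_flatDirichlet_of_lipschitz`** (`Kg = f` on `S`, bond-Lipschitz `ρ` ⇒ `(1 − θ)²·Σ_S ω e^{2ρ} g² ≤ Σ_S ω⁻¹ e^{2ρ} f²`, `ω(x) =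
  min{8,a′_{j(x)}}(L^{j(x)}η)⁻²`), ★★ **`agmon_solve_cubeMember_of_lipschitz`** (the cube member of `prop6_cubeMember_flat_of_real`, geometric hypotheses discharged by
  brick 1∕2's `towerBlock_subset_cube` ∕ `cover_cubeMember` and n05-e's `towers_disjoint_cube`).

HONEST SCOPE.  (i) Elementary real analysis + lattice bookkeeping; the exponent is still a HYPOTHESIS (now: bond-Lipschitz at the tower scale); NOT (1.101) — the
site distance realising the hypothesis with growth across collars, the counting lemma ([B6] Lemma 2.1 (2.61) analogue, where the margin threshold `ρ ≥ ρ₀(d,L,a)` of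
bus «LOCATED-ρ» enters) and the `ℓ² → ℓ^∞` step are bricks 4–5.  (ii) Print's regime `a ≤ 1` is widened to `a′_j ≤ 8` (the repaired [B4] (2.27) constant); above `8`
the block inequality saturates and `hρ2` would need `a′_j`-dependent smallness — not typed.  (iii) As bricks 1–2: the Dirichlet-on-`□₀ᶜ` matrix is the tree's
consumer-side carrier licensed by [B6] p. 228.  Count-neutral; N05 NOT discharged; one finite `T⁴` programme at fixed `ε`, Bałaban as printed; nothing continuum ∕ ℝ⁴ ∕ OS ∕
mass-gap ∕ Clay.  No `sorry`, no `def`, no `instance`, no `notation`.  Unit `pub-ymgap-dag-n05-c` (g8), 2026-08-27.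

RELATED IN THE TREE, NOT DUPLICATED: `B5CombesThomasKernel` §1 (`|e^s − 1| ≤ |s|e^{|s|}`, one-scale), `B6Geom246MultiLevelBox` (the (2.46) distance on p21's Neumann-box
BLOCK carrier `bset`, `SimpleGraph` on blocks — not a site exponent, other carrier), `T4AveragingDeficitWallBoundary.stencil_poincare`; searched 2026-08-27T11:35Z
(`rg -l 'cosh_sub_one|blockLipschitz|Lipschitz.*blockMap' Balaban1983to89/` = ∅).
-/

noncomputable section

namespace Literature.MathematicalPhysics.QuantumFieldTheory.Balaban1983to89.B8Eq191FlatDirichletLipschitzExponent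

open Finset
open B7Prop1Explicit (e)
open Literature.MathematicalPhysics.QuantumLattice (blockMap blockBase)
open B8Eq191FlatDirichletCoercive (exists_chart_eq blockMap_chart towerBlock_subset_cube)
open B8Eq191FlatDirichletConjugation (agmon_solve_flatDirichlet cover_cubeMember)
open B8Eq131CubesAdmissible (cubeFam)
open B8CubeMemberZd (cubeLamS)
open B8Eq191FlatLettersCubeMember (towers_disjoint_cube)
open Literature.MathematicalPhysics.QuantumLattice (cosh_sub_one_le_sq_of_abs_le_one)

variable {d : ℕ}

/-! ## §1 `cosh` of a small difference (the tree's `QuantumLattice.cosh_sub_one_le_sq_of_abs_le_one`: `cosh t − 1 ≤ t²` on `|t| ≤ 1`) -/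

/-- `cosh` of a difference bounded by `c ≤ 1`: `cosh(ρ_x − ρ_z) − 1 ≤ c²`. [folklore] -/
private theorem cosh_sub_one_le_of_abs_le {u v c : ℝ} (h : |u - v| ≤ c) (hc : c ≤ 1) : Real.cosh (u - v) - 1 ≤ c ^ 2 := by
  have hc0 : 0 ≤ c := (abs_nonneg _).trans h
  calc Real.cosh (u - v) - 1 ≤ (u - v) ^ 2 := cosh_sub_one_le_sq_of_abs_le_one (h.trans hc)
    _ = |u - v| ^ 2 := (sq_abs _).symm
    _ ≤ c ^ 2 := pow_le_pow_left₀ (abs_nonneg _) h 2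

/-! ## §2 A bond-Lipschitz function oscillates by at most `c·d·n` on a block of side `n + 1` -/

/-- One step inside a block: if `x, z` lie in the block `B(y)` of side `N` and `x_i < z_i`, then `x + e_i` lies in `B(y)`. [folklore]
[cite: Balaban1985RegularSpaces, p.79 (the blocks `Bʲ(y)`)] -/
theorem blockMap_add_e_of_lt {N : ℕ} (hN : 0 < N) {x z y : Fin d → ℤ} (hx : blockMap N x = y) (hz : blockMap N z = y) {i : Fin d}
    (hlt : x i < z i) : blockMap N (x + e i) = y := by
  funext ν
  have hxν := congrFun hx ν
  have hzν := congrFun hz ν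
  simp only [blockMap] at hxν hzν ⊢
  by_cases hν : ν = i
  · subst hν
    simp only [Pi.add_apply, e, Pi.single_eq_same]
    have hN' : (0 : ℤ) < (N : ℤ) := by exact_mod_cast hN
    have h1 : x ν / (N : ℤ) ≤ (x ν + 1) / (N : ℤ) := Int.ediv_le_ediv hN' (by linarith)
    have h2 : (x ν + 1) / (N : ℤ) ≤ z ν / (N : ℤ) := Int.ediv_le_ediv hN' (by linarith)
    rw [hxν] at h1; rw [hzν] at h2
    exact le_antisymm h2 h1
  · simp only [Pi.add_apply, e, Pi.single_eq_of_ne hν, add_zero]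
    exact hxν

/-- **IN-BLOCK LIPSCHITZ ⇒ ℓ¹-CONTROL**: if `|ρ(w) − ρ(w + e_i)| ≤ c` whenever `w, w + e_i ∈ B(y)`, then for `x, z ∈ B(y)`,
`|ρ(x) − ρ(z)| ≤ c·Σ_i |x_i − z_i|` (walk coordinate by coordinate inside the block — blocks are boxes). [folklore]
[cite: Balaban1984PropagatorsII, (2.46) p.231 (paths inside `Bʲ(Λ_j)`); Balaban1985RegularSpaces, p.79] -/
theorem abs_sub_le_of_blockLipschitz {N : ℕ} (hN : 0 < N) (y : Fin d → ℤ) (ρ : (Fin d → ℤ) → ℝ) {c : ℝ}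
    (hlip : ∀ w : Fin d → ℤ, blockMap N w = y → ∀ i : Fin d, blockMap N (w + e i) = y → |ρ w - ρ (w + e i)| ≤ c) :
    ∀ (m : ℕ) (x z : Fin d → ℤ), blockMap N x = y → blockMap N z = y → (∑ i : Fin d, |x i - z i|) = (m : ℤ) → |ρ x - ρ z| ≤ c * m := by
  intro m
  induction m with
  | zero =>
    intro x z hx hz hm
    have hxz : x = z := by
      funext i
      have h0 : |x i - z i| = 0 := by
        have hle : |x i - z i| ≤ ∑ i : Fin d, |x i - z i| := Finset.single_le_sum (fun i _ => abs_nonneg (x i - z i)) (Finset.mem_univ i)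
        have : (∑ i : Fin d, |x i - z i|) = 0 := by rw [hm]; simp
        linarith [abs_nonneg (x i - z i)]
      linarith [abs_eq_zero.mp h0]
    subst hxz
    simp
  | succ m ih =>
    intro x z hx hz hm
    -- a coordinate where `x` and `z` differ
    have hpos : 0 < ∑ i : Fin d, |x i - z i| := by rw [hm]; positivity
    obtain ⟨i, -, hi⟩ := Finset.exists_lt_of_sum_lt (s := (Finset.univ : Finset (Fin d))) (f := fun _ => (0 : ℤ))
      (g := fun i => |x i - z i|) (by simpa using hpos)
    have hi' : 0 < |x i - z i| := by simpa using hi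
    have hne : x i ≠ z i := fun h => by simp [h] at hi'
    rcases lt_or_gt_of_ne hne with hlt | hgt
    · -- step `x → x + e_i`
      have hx' : blockMap N (x + e i) = y := blockMap_add_e_of_lt hN hx hz hlt
      have hsum : (∑ ν : Fin d, |(x + e i) ν - z ν|) = (m : ℤ) := by
        have hsplit : ∀ ν : Fin d, |(x + e i) ν - z ν| = |x ν - z ν| - (if ν = i then 1 else 0) := by
          intro ν
          by_cases hν : ν = i
          · subst hν
            simp only [Pi.add_apply, e, Pi.single_eq_same, if_true]
            rw [abs_of_nonpos (by linarith), abs_of_neg (by linarith)]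
            ring
          · simp only [Pi.add_apply, e, Pi.single_eq_of_ne hν, add_zero, if_neg hν, sub_zero]
        rw [Finset.sum_congr rfl fun ν _ => hsplit ν, Finset.sum_sub_distrib, Finset.sum_ite_eq' Finset.univ i, if_pos (Finset.mem_univ i)]
        have : (∑ ν : Fin d, |x ν - z ν|) = (m : ℤ) + 1 := by rw [hm]; push_cast; ring
        linarith
      have h1 := hlip x hx i hx'
      have h2 := ih (x + e i) z hx' hz hsum
      calc |ρ x - ρ z| = |(ρ x - ρ (x + e i)) + (ρ (x + e i) - ρ z)| := by ring_nf
        _ ≤ |ρ x - ρ (x + e i)| + |ρ (x + e i) - ρ z| := abs_add_le _ _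
        _ ≤ c + c * m := add_le_add h1 h2
        _ = c * (m + 1 : ℕ) := by push_cast; ring
    · -- step `z → z + e_i` (symmetric roles)
      have hz' : blockMap N (z + e i) = y := blockMap_add_e_of_lt hN hz hx hgt
      have hsum : (∑ ν : Fin d, |x ν - (z + e i) ν|) = (m : ℤ) := by
        have hsplit : ∀ ν : Fin d, |x ν - (z + e i) ν| = |x ν - z ν| - (if ν = i then 1 else 0) := by
          intro ν
          by_cases hν : ν = i
          · subst hν
            simp only [Pi.add_apply, e, Pi.single_eq_same, if_true]
            rw [abs_of_nonneg (by linarith), abs_of_pos (by linarith)]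
            ring
          · simp only [Pi.add_apply, e, Pi.single_eq_of_ne hν, add_zero, if_neg hν, sub_zero]
        rw [Finset.sum_congr rfl fun ν _ => hsplit ν, Finset.sum_sub_distrib, Finset.sum_ite_eq' Finset.univ i, if_pos (Finset.mem_univ i)]
        have : (∑ ν : Fin d, |x ν - z ν|) = (m : ℤ) + 1 := by rw [hm]; push_cast; ring
        linarith
      have h1 := hlip z hz i hz'
      have h2 := ih x (z + e i) hx hz' hsum
      calc |ρ x - ρ z| = |(ρ x - ρ (z + e i)) + (ρ (z + e i) - ρ z)| := by ring_nf
        _ ≤ |ρ x - ρ (z + e i)| + |ρ (z + e i) - ρ z| := abs_add_le _ _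
        _ ≤ c * m + c := add_le_add h2 (by rw [abs_sub_comm]; exact h1)
        _ = c * (m + 1 : ℕ) := by push_cast; ring

/-- Two sites of one block of side `n + 1` differ by at most `n` in each coordinate, so `Σ_i |x_i − z_i| ≤ d·n`. [folklore]
[cite: Balaban1985RegularSpaces, p.79 (the blocks `Bʲ(y)`)] -/
theorem sum_abs_sub_le_of_block (n : ℕ) {x z y : Fin d → ℤ} (hx : blockMap (n + 1) x = y) (hz : blockMap (n + 1) z = y) :
    (∑ i : Fin d, |x i - z i|) ≤ (d : ℤ) * n := by
  obtain ⟨t, rfl⟩ := exists_chart_eq hx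
  obtain ⟨t', rfl⟩ := exists_chart_eq hz
  have hi : ∀ i : Fin d, |(blockBase (n + 1) y + fun i => ((t i : ℕ) : ℤ)) i - (blockBase (n + 1) y + fun i => ((t' i : ℕ) : ℤ)) i| ≤ (n : ℤ) := by
    intro i
    have hred : (blockBase (n + 1) y + fun i => ((t i : ℕ) : ℤ)) i - (blockBase (n + 1) y + fun i => ((t' i : ℕ) : ℤ)) i
        = ((t i : ℕ) : ℤ) - ((t' i : ℕ) : ℤ) := by
      simp only [Pi.add_apply]; ring
    rw [hred]
    have h1 : ((t i : ℕ) : ℤ) ≤ n := by exact_mod_cast Nat.lt_succ_iff.mp (t i).isLt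
    have h2 : ((t' i : ℕ) : ℤ) ≤ n := by exact_mod_cast Nat.lt_succ_iff.mp (t' i).isLt
    have h3 : (0 : ℤ) ≤ ((t i : ℕ) : ℤ) := by positivity
    have h4 : (0 : ℤ) ≤ ((t' i : ℕ) : ℤ) := by positivity
    exact abs_sub_le_iff.mpr ⟨by linarith, by linarith⟩
  calc (∑ i : Fin d, |(blockBase (n + 1) y + fun i => ((t i : ℕ) : ℤ)) i - (blockBase (n + 1) y + fun i => ((t' i : ℕ) : ℤ)) i|)
      ≤ ∑ _i : Fin d, (n : ℤ) := Finset.sum_le_sum fun i _ => hi i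
    _ = (d : ℤ) * n := by rw [Finset.sum_const, Finset.card_univ, Fintype.card_fin, nsmul_eq_mul]

/-! ## §3 A bond-Lipschitz exponent satisfies the row hypotheses `hρ1`∕`hρ2` of `B8Eq191FlatDirichletConjugation` -/

open Classical in
/-- **BLOCK OSCILLATION OF A BOND-LIPSCHITZ EXPONENT**: if the tower blocks meeting `S` lie in `S` and `|ρ(x) − ρ(x ± e_μ)| ≤ δ′·L⁻ʲ` across every bond of `S` at a
level-`j` tower site, then on each level-`j` tower block `|ρ(x) − ρ(z)| ≤ d·δ′`. [cite: Balaban1984PropagatorsII, (2.46) p.231 («d(x,x′) = d(y,y′) if x ∈ Bʲ(y), x′ ∈ Bʲ′(y′)»); Balaban1985RegularSpaces, p.79] -/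
theorem blockOsc_of_lipschitz {L : ℕ} (hL : 1 ≤ L) (m : ℕ) (Λs : ℕ → Set (Fin d → ℤ)) (S : Finset (Fin d → ℤ))
    (hfull : ∀ j, j ≤ m → ∀ x ∈ S, blockMap (L ^ j) x ∈ Λs j → ∀ z, blockMap (L ^ j) z = blockMap (L ^ j) x → z ∈ S)
    (ρ : (Fin d → ℤ) → ℝ) {δ' : ℝ} (hδ0 : 0 ≤ δ')
    (hlip : ∀ x ∈ S, ∀ j, j ≤ m → blockMap (L ^ j) x ∈ Λs j → ∀ μ : Fin d,
      (x + e μ ∈ S → |ρ x - ρ (x + e μ)| ≤ δ' * (((L : ℝ) ^ j))⁻¹) ∧ (x - e μ ∈ S → |ρ x - ρ (x - e μ)| ≤ δ' * (((L : ℝ) ^ j))⁻¹))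
    {x : Fin d → ℤ} (hx : x ∈ S) {j : ℕ} (hj : j ≤ m) (hxj : blockMap (L ^ j) x ∈ Λs j) {z : Fin d → ℤ}
    (hz : blockMap (L ^ j) z = blockMap (L ^ j) x) : |ρ x - ρ z| ≤ d * δ' := by
  obtain ⟨n, hn⟩ : ∃ n, L ^ j = n + 1 := Nat.exists_eq_succ_of_ne_zero (pow_ne_zero j (by omega))
  have hL0 : (0 : ℝ) < L := by exact_mod_cast hL
  have hLj : (0 : ℝ) < (L : ℝ) ^ j := pow_pos hL0 j
  have hN : 0 < L ^ j := by rw [hn]; exact Nat.succ_pos n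
  -- in-block Lipschitz with constant `δ′ L⁻ʲ`
  have hlipB : ∀ w : Fin d → ℤ, blockMap (L ^ j) w = blockMap (L ^ j) x → ∀ i : Fin d,
      blockMap (L ^ j) (w + e i) = blockMap (L ^ j) x → |ρ w - ρ (w + e i)| ≤ δ' * (((L : ℝ) ^ j))⁻¹ := by
    intro w hw i hwi
    have hwS : w ∈ S := hfull j hj x hx hxj w hw
    have hwiS : w + e i ∈ S := hfull j hj x hx hxj (w + e i) hwi
    have hwj : blockMap (L ^ j) w ∈ Λs j := by rw [hw]; exact hxj
    exact (hlip w hwS j hj hwj i).1 hwiS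
  have h1 := abs_sub_le_of_blockLipschitz hN (blockMap (L ^ j) x) ρ hlipB
    ((∑ i : Fin d, |x i - z i|).toNat) x z rfl hz
    (by rw [Int.toNat_of_nonneg (Finset.sum_nonneg fun i _ => abs_nonneg _)])
  have hsum : (∑ i : Fin d, |x i - z i|) ≤ (d : ℤ) * n := by
    have hx' : blockMap (n + 1) x = blockMap (L ^ j) x := by rw [← hn]
    have hz' : blockMap (n + 1) z = blockMap (L ^ j) x := by rw [← hn]; exact hz
    exact sum_abs_sub_le_of_block n hx' hz'
  have hm : (((∑ i : Fin d, |x i - z i|).toNat : ℕ) : ℝ) ≤ (d : ℝ) * n := by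
    have h0 : (0 : ℤ) ≤ ∑ i : Fin d, |x i - z i| := Finset.sum_nonneg fun i _ => abs_nonneg _
    have : (((∑ i : Fin d, |x i - z i|).toNat : ℤ)) ≤ (d : ℤ) * n := by rw [Int.toNat_of_nonneg h0]; exact hsum
    exact_mod_cast this
  have hnL : (n : ℝ) * (((L : ℝ) ^ j))⁻¹ ≤ 1 := by
    rw [mul_inv_le_iff₀ hLj, one_mul]
    have : (n : ℝ) + 1 = (L : ℝ) ^ j := by exact_mod_cast hn.symm
    linarith
  calc |ρ x - ρ z| ≤ δ' * (((L : ℝ) ^ j))⁻¹ * ((∑ i : Fin d, |x i - z i|).toNat : ℕ) := h1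
    _ ≤ δ' * (((L : ℝ) ^ j))⁻¹ * ((d : ℝ) * n) := mul_le_mul_of_nonneg_left hm (by positivity)
    _ = d * δ' * ((n : ℝ) * (((L : ℝ) ^ j))⁻¹) := by ring
    _ ≤ d * δ' * 1 := mul_le_mul_of_nonneg_left hnL (by positivity)
    _ = d * δ' := mul_one _

open Classical in
/-- **THE ROW HYPOTHESES FROM A BOND-LIPSCHITZ EXPONENT**: with level weights `a′_j = a_jη²L^{2j}L^{−dj} ∈ [a₀, 8]` (print's regime `a ≤ 1`), an exponent with
`|ρ(x) − ρ(x ± e_μ)| ≤ δ′L⁻ʲ` across the bonds of `S` at level-`j` tower sites satisfies `hρ1` and `hρ2` of `B8Eq191FlatDirichletConjugation.rowBound_flatDirichlet` as soon as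
`δ′ ≤ 1`, `dδ′ ≤ 1`, `4dδ′² ≤ θa₀`, `2d²δ′² ≤ θ` («for vectors q sufficiently small»). [cite: Balaban1984PropagatorsI, p.36; Balaban1984PropagatorsII, (2.46) p.231; Balaban1985BackgroundPropagators, (3.47) p.398] -/
theorem rowHyps_of_lipschitz {η : ℝ} {L : ℕ} (hL : 1 ≤ L) (m : ℕ) (Λs : ℕ → Set (Fin d → ℤ)) (a : ℕ → ℝ) (S : Finset (Fin d → ℤ))
    (hfull : ∀ j, j ≤ m → ∀ x ∈ S, blockMap (L ^ j) x ∈ Λs j → ∀ z, blockMap (L ^ j) z = blockMap (L ^ j) x → z ∈ S)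
    {a₀ : ℝ} (ha₀ : 0 ≤ a₀) (hlo : ∀ j, j ≤ m → a₀ ≤ a j * η ^ 2 * ((L : ℝ) ^ j) ^ 2 * (((L : ℝ) ^ d) ^ j)⁻¹)
    (hhi : ∀ j, j ≤ m → a j * η ^ 2 * ((L : ℝ) ^ j) ^ 2 * (((L : ℝ) ^ d) ^ j)⁻¹ ≤ 8)
    (ρ : (Fin d → ℤ) → ℝ) {δ' θ : ℝ} (hδ0 : 0 ≤ δ') (hδ1 : δ' ≤ 1) (hδd : (d : ℝ) * δ' ≤ 1) (hδa : 4 * (d : ℝ) * δ' ^ 2 ≤ θ * a₀)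
    (hδθ : 2 * (d : ℝ) ^ 2 * δ' ^ 2 ≤ θ)
    (hlip : ∀ x ∈ S, ∀ j, j ≤ m → blockMap (L ^ j) x ∈ Λs j → ∀ μ : Fin d,
      (x + e μ ∈ S → |ρ x - ρ (x + e μ)| ≤ δ' * (((L : ℝ) ^ j))⁻¹) ∧ (x - e μ ∈ S → |ρ x - ρ (x - e μ)| ≤ δ' * (((L : ℝ) ^ j))⁻¹)) :
    (∀ x ∈ S, ∀ j, j ≤ m → blockMap (L ^ j) x ∈ Λs j → ∀ μ : Fin d,
      (x + e μ ∈ S → 4 * (d : ℝ) * (Real.cosh (ρ x - ρ (x + e μ)) - 1) ≤ θ * min 8 (a j * η ^ 2 * ((L : ℝ) ^ j) ^ 2 * (((L : ℝ) ^ d) ^ j)⁻¹) * (((L : ℝ) ^ j) ^ 2)⁻¹) ∧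
      (x - e μ ∈ S → 4 * (d : ℝ) * (Real.cosh (ρ x - ρ (x - e μ)) - 1) ≤ θ * min 8 (a j * η ^ 2 * ((L : ℝ) ^ j) ^ 2 * (((L : ℝ) ^ d) ^ j)⁻¹) * (((L : ℝ) ^ j) ^ 2)⁻¹)) ∧
    (∀ x ∈ S, ∀ j, j ≤ m → blockMap (L ^ j) x ∈ Λs j → ∀ z ∈ S, blockMap (L ^ j) z = blockMap (L ^ j) x →
      2 * (a j * η ^ 2 * ((L : ℝ) ^ j) ^ 2 * (((L : ℝ) ^ d) ^ j)⁻¹) * (Real.cosh (ρ x - ρ z) - 1) ≤ θ * min 8 (a j * η ^ 2 * ((L : ℝ) ^ j) ^ 2 * (((L : ℝ) ^ d) ^ j)⁻¹)) := by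
  have hL0 : (0 : ℝ) < L := by exact_mod_cast hL
  have hscale : ∀ j : ℕ, (((L : ℝ) ^ j))⁻¹ ≤ 1 := fun j =>
    inv_le_one_of_one_le₀ (one_le_pow₀ (by exact_mod_cast hL))
  refine ⟨?_, ?_⟩
  · intro x hx j hj hxj μ
    have hmin : a₀ ≤ min 8 (a j * η ^ 2 * ((L : ℝ) ^ j) ^ 2 * (((L : ℝ) ^ d) ^ j)⁻¹) := le_min ((hlo j hj).trans (hhi j hj)) (hlo j hj)
    have hc1 : δ' * (((L : ℝ) ^ j))⁻¹ ≤ 1 := by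
      calc δ' * (((L : ℝ) ^ j))⁻¹ ≤ 1 * 1 := mul_le_mul hδ1 (hscale j) (by positivity) zero_le_one
        _ = 1 := one_mul 1
    have key : ∀ x' : Fin d → ℤ, |ρ x - ρ x'| ≤ δ' * (((L : ℝ) ^ j))⁻¹ →
        4 * (d : ℝ) * (Real.cosh (ρ x - ρ x') - 1) ≤ θ * min 8 (a j * η ^ 2 * ((L : ℝ) ^ j) ^ 2 * (((L : ℝ) ^ d) ^ j)⁻¹) * (((L : ℝ) ^ j) ^ 2)⁻¹ := by
      intro x' h
      have hcosh := cosh_sub_one_le_of_abs_le h hc1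
      have hsq : (δ' * (((L : ℝ) ^ j))⁻¹) ^ 2 = δ' ^ 2 * (((L : ℝ) ^ j) ^ 2)⁻¹ := by rw [mul_pow, inv_pow]
      rw [hsq] at hcosh
      have hpos : 0 ≤ (((L : ℝ) ^ j) ^ 2)⁻¹ := by positivity
      calc 4 * (d : ℝ) * (Real.cosh (ρ x - ρ x') - 1) ≤ 4 * (d : ℝ) * (δ' ^ 2 * (((L : ℝ) ^ j) ^ 2)⁻¹) :=
            mul_le_mul_of_nonneg_left hcosh (by positivity)
        _ = (4 * (d : ℝ) * δ' ^ 2) * (((L : ℝ) ^ j) ^ 2)⁻¹ := by ring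
        _ ≤ (θ * a₀) * (((L : ℝ) ^ j) ^ 2)⁻¹ := mul_le_mul_of_nonneg_right hδa hpos
        _ ≤ (θ * min 8 (a j * η ^ 2 * ((L : ℝ) ^ j) ^ 2 * (((L : ℝ) ^ d) ^ j)⁻¹)) * (((L : ℝ) ^ j) ^ 2)⁻¹ :=
            mul_le_mul_of_nonneg_right (mul_le_mul_of_nonneg_left hmin (le_trans (by positivity) hδθ)) hpos
    exact ⟨fun hs => key _ ((hlip x hx j hj hxj μ).1 hs), fun hs => key _ ((hlip x hx j hj hxj μ).2 hs)⟩
  · intro x hx j hj hxj z hzS hz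
    have hosc := blockOsc_of_lipschitz hL m Λs S hfull ρ hδ0 hlip hx hj hxj hz
    have hcosh := cosh_sub_one_le_of_abs_le hosc hδd
    have ha8 : (a j * η ^ 2 * ((L : ℝ) ^ j) ^ 2 * (((L : ℝ) ^ d) ^ j)⁻¹) ≤ 8 := hhi j hj
    have ha0 : 0 ≤ (a j * η ^ 2 * ((L : ℝ) ^ j) ^ 2 * (((L : ℝ) ^ d) ^ j)⁻¹) := ha₀.trans (hlo j hj)
    have hmin : min 8 (a j * η ^ 2 * ((L : ℝ) ^ j) ^ 2 * (((L : ℝ) ^ d) ^ j)⁻¹) = (a j * η ^ 2 * ((L : ℝ) ^ j) ^ 2 * (((L : ℝ) ^ d) ^ j)⁻¹) := min_eq_right ha8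
    rw [hmin]
    calc 2 * (a j * η ^ 2 * ((L : ℝ) ^ j) ^ 2 * (((L : ℝ) ^ d) ^ j)⁻¹) * (Real.cosh (ρ x - ρ z) - 1) ≤ 2 * (a j * η ^ 2 * ((L : ℝ) ^ j) ^ 2 * (((L : ℝ) ^ d) ^ j)⁻¹) * ((d : ℝ) * δ') ^ 2 :=
          mul_le_mul_of_nonneg_left hcosh (by positivity)
      _ = (2 * (d : ℝ) ^ 2 * δ' ^ 2) * (a j * η ^ 2 * ((L : ℝ) ^ j) ^ 2 * (((L : ℝ) ^ d) ^ j)⁻¹) := by ring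
      _ ≤ θ * (a j * η ^ 2 * ((L : ℝ) ^ j) ^ 2 * (((L : ℝ) ^ d) ^ j)⁻¹) := mul_le_mul_of_nonneg_right hδθ ha0

/-! ## §4 The weighted-`ℓ²` decay estimate for bond-Lipschitz exponents -/

open Classical in
/-- **THE AGMON ESTIMATE FOR A BOND-LIPSCHITZ EXPONENT** (flat Dirichlet multi-level kernel, any finite `S` with tower geometry `hfull`∕`hdisj`∕`hcover`, level weights
`a′_j ∈ [a₀, 8]`, `a_j > 0`): if `Kg = f` on `S` and `|ρ(x) − ρ(x ± e_μ)| ≤ δ′·L⁻ʲ` across every bond of `S` at a level-`j` tower site, with `δ′ ≤ 1`, `dδ′ ≤ 1`,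
`4dδ′² ≤ θa₀`, `2d²δ′² ≤ θ < 1`, then `(1 − θ)²·Σ_S ω e^{2ρ} g² ≤ Σ_S ω⁻¹ e^{2ρ} f²`.
[cite: Balaban1984PropagatorsI, p.36, (1.114) p.36; Balaban1985BackgroundPropagators, Thm 3.1 (3.47) p.398; Balaban1985RegularSpaces, (1.101) p.93; Balaban1984PropagatorsII, p.228, (2.46) p.231] -/
theorem agmon_solve_flatDirichlet_of_lipschitz {η : ℝ} (hη : η ≠ 0) {L : ℕ} (hL : 1 ≤ L) (m : ℕ) (Λs : ℕ → Set (Fin d → ℤ)) (a : ℕ → ℝ)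
    (ha : ∀ j, 0 < a j) (K : (Fin d → ℤ) → (Fin d → ℤ) → ℝ)
    (hK : ∀ x z, K x z = ((η ^ 2)⁻¹ * ∑ μ : Fin d, ((2 : ℝ) * (if z = x then (1 : ℝ) else 0) - (if z = x + e μ then (1 : ℝ) else 0)
        - (if z = x - e μ then (1 : ℝ) else 0))) +
        (∑ j ∈ Finset.range (m + 1), (if blockMap (L ^ j) x ∈ Λs j ∧ blockMap (L ^ j) z = blockMap (L ^ j) x then
          a j * ((((L : ℝ) ^ d)⁻¹) ^ j) ^ 2 else 0)))
    (S : Finset (Fin d → ℤ))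
    (hfull : ∀ j, j ≤ m → ∀ x ∈ S, blockMap (L ^ j) x ∈ Λs j → ∀ z, blockMap (L ^ j) z = blockMap (L ^ j) x → z ∈ S)
    (hdisj : ∀ x ∈ S, ∀ j, j ≤ m → ∀ j', j' ≤ m → blockMap (L ^ j) x ∈ Λs j → blockMap (L ^ j') x ∈ Λs j' → j = j')
    (hcover : ∀ x ∈ S, ∃ j, j ≤ m ∧ blockMap (L ^ j) x ∈ Λs j)
    {a₀ : ℝ} (ha₀ : 0 ≤ a₀) (hlo : ∀ j, j ≤ m → a₀ ≤ a j * η ^ 2 * ((L : ℝ) ^ j) ^ 2 * (((L : ℝ) ^ d) ^ j)⁻¹)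
    (hhi : ∀ j, j ≤ m → a j * η ^ 2 * ((L : ℝ) ^ j) ^ 2 * (((L : ℝ) ^ d) ^ j)⁻¹ ≤ 8)
    (ρ : (Fin d → ℤ) → ℝ) {δ' θ : ℝ} (hδ0 : 0 ≤ δ') (hδ1 : δ' ≤ 1) (hδd : (d : ℝ) * δ' ≤ 1) (hδa : 4 * (d : ℝ) * δ' ^ 2 ≤ θ * a₀)
    (hδθ : 2 * (d : ℝ) ^ 2 * δ' ^ 2 ≤ θ) (hθ1 : θ < 1)
    (hlip : ∀ x ∈ S, ∀ j, j ≤ m → blockMap (L ^ j) x ∈ Λs j → ∀ μ : Fin d,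
      (x + e μ ∈ S → |ρ x - ρ (x + e μ)| ≤ δ' * (((L : ℝ) ^ j))⁻¹) ∧ (x - e μ ∈ S → |ρ x - ρ (x - e μ)| ≤ δ' * (((L : ℝ) ^ j))⁻¹))
    (g f : (Fin d → ℤ) → ℝ) (hg : ∀ w, w ∉ S → g w = 0) (hKg : ∀ x ∈ S, ∑ z ∈ S, K x z * g z = f x) :
    (1 - θ) ^ 2 * ∑ x ∈ S, (fun x => ∑ j ∈ Finset.range (m + 1), (if blockMap (L ^ j) x ∈ Λs j then min 8 (a j * η ^ 2 * ((L : ℝ) ^ j) ^ 2 * (((L : ℝ) ^ d) ^ j)⁻¹) * (((L : ℝ) ^ j * η) ^ 2)⁻¹ else 0)) x * Real.exp (2 * ρ x) * g x ^ 2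
      ≤ ∑ x ∈ S, ((fun x => ∑ j ∈ Finset.range (m + 1), (if blockMap (L ^ j) x ∈ Λs j then min 8 (a j * η ^ 2 * ((L : ℝ) ^ j) ^ 2 * (((L : ℝ) ^ d) ^ j)⁻¹) * (((L : ℝ) ^ j * η) ^ 2)⁻¹ else 0)) x)⁻¹ * Real.exp (2 * ρ x) * f x ^ 2 := by
  obtain ⟨hρ1, hρ2⟩ := rowHyps_of_lipschitz (η := η) hL m Λs a S hfull ha₀ hlo hhi ρ hδ0 hδ1 hδd hδa hδθ hlip
  exact agmon_solve_flatDirichlet hη hL m Λs a ha K hK S hfull hdisj hcover ρ (le_trans (by positivity) hδθ) hθ1 hρ1 hρ2 g f hg hKg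

open Classical in
/-- **THE AGMON ESTIMATE AT THE CONCRETE CUBE MEMBER FOR A BOND-LIPSCHITZ EXPONENT** — letters `S = □₀`, `K` at `(η, L, n, cubeLamS, w)` of
`B8Prop6CubeMemberFlatScalar.prop6_cubeMember_flat_of_real`, weights `w′_j = w_jη²L^{2j}L^{−dj} ∈ [a₀, 8]`, `w_j > 0`; the geometric hypotheses are DISCHARGED, the
only hypothesis on the exponent is the bond-Lipschitz condition at the tower level.
[cite: Balaban1985RegularSpaces, (1.101) p.93, (1.131) p.99; Balaban1984PropagatorsI, p.36; Balaban1984PropagatorsII, p.228, (2.46) p.231] -/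
theorem agmon_solve_cubeMember_of_lipschitz {η : ℝ} (hη : η ≠ 0) {L : ℕ} (hL : 1 ≤ L) (a : Fin d → ℤ) (M : ℕ) {ρc : ℕ} (hρc : L ≤ ρc)
    {k n : ℕ} (hn : n ≤ k) (w : ℕ → ℝ) (hw : ∀ j, 0 < w j) (S : Finset (Fin d → ℤ)) (hS : ∀ x, x ∈ S ↔ x ∈ cubeFam false L a M ρc k 0)
    (K : (Fin d → ℤ) → (Fin d → ℤ) → ℝ)
    (hK : ∀ x z, K x z = ((η ^ 2)⁻¹ * ∑ μ : Fin d, ((2 : ℝ) * (if z = x then (1 : ℝ) else 0) - (if z = x + e μ then (1 : ℝ) else 0)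
        - (if z = x - e μ then (1 : ℝ) else 0))) +
        (∑ j ∈ Finset.range (n + 1), (if blockMap (L ^ j) x ∈ cubeLamS L a M ρc k n j ∧ blockMap (L ^ j) z = blockMap (L ^ j) x then
          w j * ((((L : ℝ) ^ d)⁻¹) ^ j) ^ 2 else 0)))
    {a₀ : ℝ} (ha₀ : 0 ≤ a₀) (hlo : ∀ j, j ≤ n → a₀ ≤ w j * η ^ 2 * ((L : ℝ) ^ j) ^ 2 * (((L : ℝ) ^ d) ^ j)⁻¹)
    (hhi : ∀ j, j ≤ n → w j * η ^ 2 * ((L : ℝ) ^ j) ^ 2 * (((L : ℝ) ^ d) ^ j)⁻¹ ≤ 8)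
    (ρ : (Fin d → ℤ) → ℝ) {δ' θ : ℝ} (hδ0 : 0 ≤ δ') (hδ1 : δ' ≤ 1) (hδd : (d : ℝ) * δ' ≤ 1) (hδa : 4 * (d : ℝ) * δ' ^ 2 ≤ θ * a₀)
    (hδθ : 2 * (d : ℝ) ^ 2 * δ' ^ 2 ≤ θ) (hθ1 : θ < 1)
    (hlip : ∀ x ∈ S, ∀ j, j ≤ n → blockMap (L ^ j) x ∈ cubeLamS L a M ρc k n j → ∀ μ : Fin d,
      (x + e μ ∈ S → |ρ x - ρ (x + e μ)| ≤ δ' * (((L : ℝ) ^ j))⁻¹) ∧ (x - e μ ∈ S → |ρ x - ρ (x - e μ)| ≤ δ' * (((L : ℝ) ^ j))⁻¹))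
    (g f : (Fin d → ℤ) → ℝ) (hg : ∀ x, x ∉ S → g x = 0) (hKg : ∀ x ∈ S, ∑ z ∈ S, K x z * g z = f x) :
    (1 - θ) ^ 2 * ∑ x ∈ S, (∑ j ∈ Finset.range (n + 1), (if blockMap (L ^ j) x ∈ cubeLamS L a M ρc k n j then
        min 8 (w j * η ^ 2 * ((L : ℝ) ^ j) ^ 2 * (((L : ℝ) ^ d) ^ j)⁻¹) * (((L : ℝ) ^ j * η) ^ 2)⁻¹ else 0)) * Real.exp (2 * ρ x) * g x ^ 2
      ≤ ∑ x ∈ S, (∑ j ∈ Finset.range (n + 1), (if blockMap (L ^ j) x ∈ cubeLamS L a M ρc k n j then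
        min 8 (w j * η ^ 2 * ((L : ℝ) ^ j) ^ 2 * (((L : ℝ) ^ d) ^ j)⁻¹) * (((L : ℝ) ^ j * η) ^ 2)⁻¹ else 0))⁻¹ * Real.exp (2 * ρ x) * f x ^ 2 :=
  agmon_solve_flatDirichlet_of_lipschitz hη hL n (cubeLamS L a M ρc k n) w hw K hK S
    (fun _ hj _ _ hxj z hz => (hS z).mpr (towerBlock_subset_cube hL a M hρc hn hj hxj hz))
    (fun x hx j hj j' hj' h1 h2 => (towers_disjoint_cube hL a M hρc hn j hj j' hj' _ h1 _ h2 x ((hS x).mp hx) rfl rfl).1)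
    (fun x hx => cover_cubeMember hL a M hρc hn x ((hS x).mp hx)) ha₀ hlo hhi ρ hδ0 hδ1 hδd hδa hδθ hθ1 hlip g f hg hKg

end Literature.MathematicalPhysics.QuantumFieldTheory.Balaban1983to89.B8Eq191FlatDirichletLipschitzExponent

end
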